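import Summits.BirchSwinnertonDyer.BirchSwinnertonDyer.Theorems.ByReductionTypeAtTwoOrdKatoHalfAtTwoIsoPosDiscDefs
import Literature.NumberTheory.EllipticCurves.FineSelmerClassGroupCriterion
import HarnessLib

/-!
# Route ByReductionTypeAtTwo, crux `OrdKatoHalfAtTwoIso` (stmt-BirchSwinnertonDyer-19573), child PAIR
# `OrdKatoFineZetaAtTwoResidue` (stmt-BirchSwinnertonDyer-24097), line `steinberg-fibre-at-two`: the three DISPLAYED TEXTS of
# the (ε) re-cut of the `0 < Δ` conjunct — P⁺ (span-free ι-keyed Coleman `μ`-package), Q⁺ (Coates–Sujatha (A) at `2`),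
# Iw⁺ (Iwasawa's `μ₂ = 0` for `ℚ(E[2], √−1)`) — definitions only, nothing asserted

Seat `cruxlead-stmt-BirchSwinnertonDyer-19573-g6` (LEAD PROVER, MODE LINE; HOME `run/shared/lean/pub/bsd-2adic/`; pen RC-391 (3)
«(ε) = the lead's skeleton business», RC-400 (ii)). DEFINITIONS of three OPEN statements displayed BY NAME, their `Iff.rfl`
unfoldings and monotonicity lemmas. HONEST FRAMING (cell bsd-2adic): BSD is not proved by any of this; neither the crux
`OrdKatoHalfAtTwoIso` nor its PAIR child nor the `0 < Δ` conjunct `OrdKatoHalfAtTwoIsoPosDisc` is proved; the three definitions are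
`@[conjecture]` obligation nodes, NOT Literature facts, nothing is asserted about them. The kernel door consuming them
(P⁺ → Q⁺ → Abbes–Ullmo → Kato 17.4 (1)(2) ⇒ `OrdKatoHalfAtTwoIsoPosDisc`) is the sequel `…OrdKatoHalfAtTwoIsoPosDiscEpsilon.lean`.

WHY (crux-triage r1 seat 2, `Cruxes/OrdKatoHalfAtTwoIso/TRIAGE-r1-2.md` GEN 32 Thm C / GEN 33 Thm E–F, pen RC-391; lead g5
`RELINE-posDisc.md`, finding F-27a). On the cell [`ρ̄_{W,2}` onto ∧ `0 < Δ_W`] of the crux the line's Euler-system mechanism is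
void as typed: on a rectangular period lattice every corestricted Kato class is `2`-divisible in `𝐇¹_Iw(ℚ_∞, T₂W)` (Thm E: Galois
descent along `ℚ(ζ_{2^∞})/ℚ_∞`, `(1 ± ι)T = 2T^±`; periods F-27a: `c_∞ = 2`), so the span clause «`Z` inside the span of GENUINE
classes» of the F1 reading and the premise «a genuine class `∉ 2𝐇¹`» of CoreA⁺ (child 23967, PROVED) have no Kato witness there.
What survives is (Thm F): the HALF class `y′ := res⁻¹(z̃_{γ⁺})` is canonical with `ℓ(y′) = u·M̃·G₁ ∉ (2)`, whence
`μ(X(W/ℚ_∞)) = μ(X₀^{str ∞}(W/ℚ_∞))` and the cell's beyond-print content is EXACTLY Coates–Sujatha's Conjecture A at `2`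
(∞-strict = the tree's `fineSelmerInfty` / `FineSelmerDualData` convention) plus the span-free Coleman reading. The width
seat w2 landed the consuming `μ`-door in the kernel (`…IrrMuDoor`, `mu_eq_zero_of_unitMultiple_of_exact_of_finite_fineSelmer_pTorsion`:
an ideal `P`, `M ⊆ P` killed by the column map, exactness before `X ↠ X₀`, one `s·G₁ ∈ M` with `s, G₁ ∉ (2)`, and
`Sel₀(E/ℚ_∞)[2]` finite ⇒ `μ(X) = 0` — no `𝐇¹`, no Euler system, no Chebotarev). Hence the (ε) re-cut of the conjunct:

* P⁺ `ColemanMuSpanFreeIotaPosDiscAtTwo` — the SPAN-FREE, `𝐇¹`-FREE Coleman `μ`-package on the cell, column map ι-SEMILINEAR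
  (`ι = IwasawaAlgebra.involEquiv 2`, the honest keying of the local Tate pairing, w3 p690167/p691108): VERBATIM the body of
  `ZetaColemanMuIotaNegDiscAtTwo` (p693557) with the pinned `𝐇¹` `I`, the zeta module `Z ⊆ 𝐇¹`, the map `ℓ` and the span clause
  REMOVED (a submodule `M ⊆ P` replaces `ℓ(Z)`), the three `T₂W`-instance binders dropped (no `𝐇¹` datum is formed), and
  `W.Δ < 0` replaced by `0 < W.Δ`. MEMO tier: Kato-witnessed by `M := Λ·ℓ(y′)` (Thm F (F4): F-27a exact ÷ 2, reciprocity for the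
  global class `y′`, Poitou–Tate), the SAME tier as F1μι⁻ on `Δ < 0`; NOT in print as stated.
* Q⁺ `FineSelmerConjATwoOrdPosDisc` — Coates–Sujatha's statement (A) at `(W, 2)` on the cell, in the route's own currency
  (K4 child 22615 `FineSelmerConjAAtTwoAdditivePotGood`: `∀ κ` cyclotomic, `∃ γ D`, `Module.Finite ℤ₂ D.X` for a fine Selmer dual
  datum; Lim 2017's `∃ γ D` spelling). RESEARCH: `ℚ(E[2])` is a totally real non-abelian `S₃`-sextic there, so neither
  Ferrero–Washington nor the tree's abelian road (`…ConjATwoOfNotSurjective`, w2) applies.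
* Iw⁺ `ClassicalMuTwoDivisionFieldAdjoinIOrdPosDisc` — Iwasawa's classical `μ = 0` (1973) for the cyclotomic `ℤ₂`-extension of
  the totally imaginary degree-`12` field `ℚ(E[2], √−1)` (`Gal = S₃ × C₂`) on the cell: the honest carrier of Lim 2017 Thm. 3.5 at
  `2` (`Lim2017.thm35_at_two_…_of_le_divisionField_four`, scope rider «instantiate `L ∋ √−1`»), through which Q⁺ is supplied BY
  NAME (tree `AddKatoTwo.conjA_two_of_classicalMu_divisionField_two_adjoin_I`, any curve; sequel file) and per curve by Fukuda
  class-group certificates (`AddKatoTwo.conjA_two_of_fukudaCertificate_divisionField_two_adjoin_I`). OPEN as a `∀` (classical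
  named conjecture, non-abelian ground field).

References: K. Kato, Astérisque 295 (2004) Thm. 12.4–12.6, (14.9.3), Thm. 16.6, Prop. 17.11, §17.13 [Kato2004Asterisque];
J. Coates, R. Sujatha, Math. Ann. 331 (2005) Conj. A, Thm. 3.4 [CoatesSujatha2005]; M. F. Lim, Asian J. Math. 21 (2017) Thm. 3.5,
Lemma 3.2 [Lim2017FineSelmer]; K. Iwasawa, in: Number Theory, Algebraic Geometry and Commutative Algebra (1973) [Iwasawa1973MuInvariants];
R. Greenberg, LNM 1716 (1999) §1 p. 60, Conj. 1.11 [GreenbergLNM1716]; tree p693557 (`…PosDiscDefs`), p695020 (`…PosDiscSplit`),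
w2 `…IrrMuDoor`, addL2x `…AdditiveKatoFineDivisionFieldFourI`, triage evidence #48/#55 on stmt-19573.
-/

set_option autoImplicit false
set_option linter.dupNamespace false

noncomputable section

open scoped Classical MatrixGroups ModularForm NumberField
open CongruenceSubgroup WeierstrassCurve Field IsDedekindDomain NumberField
open Literature.NumberTheory.GaloisRepresentations
open Literature.NumberTheory.GaloisCohomology
open Literature.NumberTheory.EllipticCurves Literature.NumberTheory.EllipticCurves.ModularForms
open Literature.NumberTheory.EllipticCurves.Kato2004
  Literature.NumberTheory.EllipticCurves.Kato2004.EulerSystemValues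
open Literature.NumberTheory.EllipticCurves.Rank1Residual
open Literature.NumberTheory.EllipticCurves.Greenberg1999
open Literature.NumberTheory.IwasawaTheory
open Summit.BirchSwinnertonDyer.BirchSwinnertonDyer.Theorems.Rank1ResidualX1Defs
  Summit.BirchSwinnertonDyer.BirchSwinnertonDyer.Rank1Residual
  Summit.BirchSwinnertonDyer.BirchSwinnertonDyer.Rank1Residual.CoreAssembly
open Summit.BirchSwinnertonDyer.Rank1Residual Summit.BirchSwinnertonDyer.Rank1Residual.X5
open Summit.BirchSwinnertonDyer.BirchSwinnertonDyer.Theorems.OrdKatoOptimalAtTwo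
  Summit.BirchSwinnertonDyer.BirchSwinnertonDyer.Theorems.OrdKatoIntAtTwo
open Summit.BirchSwinnertonDyer.BirchSwinnertonDyer.Theses.ByReductionTypeAtTwo

namespace Summit.BirchSwinnertonDyer.BirchSwinnertonDyer.Theorems.SteinbergFibreAtTwo

/-! ## §1 P⁺ — the span-free, ι-keyed Coleman `μ`-package on the cell [`ρ̄₂` onto ∧ `0 < Δ`] -/

/-- [MEMO tier, OPEN] **P⁺ — the SPAN-FREE ι-keyed Coleman `μ`-package at `p = 2` on `0 < Δ` (lead g6, (ε) text).**
For every globally minimal `W`, good ordinary at `2`, `ρ̄_{W,2}` onto, `0 < Δ_W` (two real components), its newform `f`, the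
cyclotomic `(κ, γ)`, every Selmer dual datum `D` (`X = X(W/ℚ_∞)`) and fine datum `Y` (`X₀`, STRICT at `∞`): an ideal `P ⊆ Λ`,
a submodule `M ⊆ P`, an `ι`-SEMILINEAR column map `τ : P →ₛₗ[ι] X` (`ι = IwasawaAlgebra.involEquiv 2`, `T ↦ (1+T)⁻¹ − 1`)
killing `M` with image `ker(X ↠ X₀)` (`π` onto, `Function.Exact τ π`), and the image clause at `(2)`: for every `G₁ ∈ Λ` with
`ι G₁ = L₂(f, α)` some `s ∉ (2)` has `s·G₁ ∈ M`. VERBATIM the body of `ZetaColemanMuIotaNegDiscAtTwo` (p693557) with the pinned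
`𝐇¹`, the zeta module `Z`, the map `ℓ` and the Euler-system span clause REMOVED (`M` replaces `ℓ(Z)`; the three
`T₂W`-instance binders, needed only to form `𝐇¹`, dropped) and `W.Δ < 0` replaced by `0 < W.Δ`. Kato-witnessed at memo tier by
`M := Λ·ℓ(y′)`, `y′ = res⁻¹(z̃_{γ⁺}) ∈ 𝐇¹_Iw(ℚ_∞, T₂W)` the canonical HALF class of a rectangular lattice (`Cor z̃_{γ⁺} = 2y′`,
`ℓ(y′) = u·M̃·G₁ ∉ (2)`: triage Thm E/F, lead F-27a ÷ 2; `τ(ℓ y′) = 0` by reciprocity for the global class `y′`; exactness by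
Poitou–Tate). A READING of Kato §§12–17 at `2`, NOT in print as stated; NOT a Literature fact; nothing asserted.
[cite: Kato2004Asterisque, Thm. 12.5 (1) (p. 221), Thm. 12.6 (p. 222), (14.9.3) (p. 240), Thm. 16.6 (p. 271), Prop. 17.11 (p. 277), §17.13 (pp. 279–280) (shape only; nothing asserted)] -/
@[conjecture] def ColemanMuSpanFreeIotaPosDiscAtTwo : Prop :=
  ∀ (W : WeierstrassCurve ℚ) [W.IsElliptic] [W.IsGloballyMinimal]
      {N : ℕ} [NeZero N] (f : CuspForm (Gamma0 N) 2)
      (κ : ZpExtension ℚ 2) (γ : absoluteGaloisGroup ℚ), κ.IsCyclotomic →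
      IsOrdinaryAt W 2 → W.HasSurjectiveModNGaloisRep 2 → 0 < W.Δ →
      κ.IsTopGenerator γ → IsCyclotomicVariable 2 γ → IsNewformOf W f →
      ∀ (D : W.SelmerDualData κ γ) (Y : W.FineSelmerDualData κ γ),
        ∃ (P : Submodule (IwasawaAlgebra 2) (IwasawaAlgebra 2)) (M : Submodule (IwasawaAlgebra 2) P)
          (τ : P →ₛₗ[((IwasawaAlgebra.involEquiv 2).toRingEquiv : IwasawaAlgebra 2 →+* IwasawaAlgebra 2)] D.X)
          (π : D.X →ₗ[IwasawaAlgebra 2] Y.X),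
          (∀ m ∈ M, τ m = 0) ∧ Function.Surjective π ∧ Function.Exact τ π ∧
          ∀ G₁ : IwasawaAlgebra 2,
            iwasawaToPowerSeries 2 G₁ = padicLFunction f (unitRoot W 2 : ℚ_[2]) →
              ∃ s : IwasawaAlgebra 2, s ∉ IwasawaAlgebra.augIdealP 2 ∧ s * G₁ ∈ Submodule.map P.subtype M

/-- `ColemanMuSpanFreeIotaPosDiscAtTwo` unfolds to its displayed body. [folklore] -/
theorem colemanMuSpanFreeIotaPosDiscAtTwo_iff : ColemanMuSpanFreeIotaPosDiscAtTwo ↔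
    ∀ (W : WeierstrassCurve ℚ) [W.IsElliptic] [W.IsGloballyMinimal]
      {N : ℕ} [NeZero N] (f : CuspForm (Gamma0 N) 2)
      (κ : ZpExtension ℚ 2) (γ : absoluteGaloisGroup ℚ), κ.IsCyclotomic →
      IsOrdinaryAt W 2 → W.HasSurjectiveModNGaloisRep 2 → 0 < W.Δ →
      κ.IsTopGenerator γ → IsCyclotomicVariable 2 γ → IsNewformOf W f →
      ∀ (D : W.SelmerDualData κ γ) (Y : W.FineSelmerDualData κ γ),
        ∃ (P : Submodule (IwasawaAlgebra 2) (IwasawaAlgebra 2)) (M : Submodule (IwasawaAlgebra 2) P)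
          (τ : P →ₛₗ[((IwasawaAlgebra.involEquiv 2).toRingEquiv : IwasawaAlgebra 2 →+* IwasawaAlgebra 2)] D.X)
          (π : D.X →ₗ[IwasawaAlgebra 2] Y.X),
          (∀ m ∈ M, τ m = 0) ∧ Function.Surjective π ∧ Function.Exact τ π ∧
          ∀ G₁ : IwasawaAlgebra 2,
            iwasawaToPowerSeries 2 G₁ = padicLFunction f (unitRoot W 2 : ℚ_[2]) →
              ∃ s : IwasawaAlgebra 2, s ∉ IwasawaAlgebra.augIdealP 2 ∧ s * G₁ ∈ Submodule.map P.subtype M :=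
  Iff.rfl

/-- **Monotonicity: a sign-free ι-keyed zeta/Coleman supply WITH `𝐇¹` and the span clause (the v12 text F1μ⁺ι, hypothesis
`hZθ` of p691807 at `θ = ι`) implies P⁺** — forget `𝐇¹`, `Z` and genuineness (`M := ℓ(Z)`), restrict to `0 < Δ`. So every habitat
on which the F1 reading holds sign-free feeds the (ε) door; the converse fails on `0 < Δ` (F-27a / triage Thm E). [folklore] -/
theorem colemanMuSpanFreeIotaPosDiscAtTwo_of_iota_signFree
    (hZι : ∀ (W : WeierstrassCurve ℚ) [W.IsElliptic] [W.IsGloballyMinimal]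
      [ContinuousSMul ℤ_[2] (W.tateModule 2)] [Module.Free ℤ_[2] (W.tateModule 2)]
      [Module.Finite ℤ_[2] (W.tateModule 2)] {N : ℕ} [NeZero N] (f : CuspForm (Gamma0 N) 2)
      (κ : ZpExtension ℚ 2) (γ : absoluteGaloisGroup ℚ) (hκ : κ.IsCyclotomic),
      IsOrdinaryAt W 2 → W.HasSurjectiveModNGaloisRep 2 →
      κ.IsTopGenerator γ → IsCyclotomicVariable 2 γ → IsNewformOf W f →
      ∀ (D : W.SelmerDualData κ γ) (Y : W.FineSelmerDualData κ γ),
        ∃ (I : IwasawaH1Data W 2 κ γ)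
          (Z : Submodule (IwasawaAlgebra 2) I.H) (P : Submodule (IwasawaAlgebra 2) (IwasawaAlgebra 2))
          (ℓ : I.H →ₗ[IwasawaAlgebra 2] P)
          (τ : P →ₛₗ[((IwasawaAlgebra.involEquiv 2).toRingEquiv : IwasawaAlgebra 2 →+* IwasawaAlgebra 2)] D.X)
          (π : D.X →ₗ[IwasawaAlgebra 2] Y.X),
          Z ≤ Submodule.span (IwasawaAlgebra 2) {s : I.H | IsEulerSystemClassTwo W hκ I s} ∧
          (∀ z ∈ Z, τ (ℓ z) = 0) ∧ Function.Surjective π ∧ Function.Exact τ π ∧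
          ∀ G₁ : IwasawaAlgebra 2,
            iwasawaToPowerSeries 2 G₁ = padicLFunction f (unitRoot W 2 : ℚ_[2]) →
              ∃ s : IwasawaAlgebra 2, s ∉ IwasawaAlgebra.augIdealP 2 ∧
                s * G₁ ∈ Submodule.map (P.subtype ∘ₗ ℓ) Z) :
    ColemanMuSpanFreeIotaPosDiscAtTwo := by
  intro W _ _ N _ f κ γ hκ hord h2 _ hγ hγ' hf D Y
  haveI : ContinuousSMul ℤ_[2] (W.tateModule 2) := TateModule.continuousSMul_padicInt
  haveI : Module.Free ℤ_[2] (W.tateModule 2) := W.module_free_tateModule_holds 2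
  haveI : Module.Finite ℤ_[2] (W.tateModule 2) := W.module_finite_tateModule_holds 2
  obtain ⟨I, Z, P, ℓ, τ, π, -, hτℓ, hπs, hπ, himg⟩ := hZι W f κ γ hκ hord h2 hγ hγ' hf D Y
  refine ⟨P, Submodule.map ℓ Z, τ, π, ?_, hπs, hπ, fun G₁ hG₁ ↦ ?_⟩
  · rintro _ ⟨z, hz, rfl⟩
    exact hτℓ z hz
  · obtain ⟨s, hs, hsG⟩ := himg G₁ hG₁
    exact ⟨s, hs, by rw [← Submodule.map_comp]; exact hsG⟩

/-! ## §2 Q⁺ — Coates–Sujatha's statement (A) at `2` on the cell, in the route's currency -/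

/-- [RESEARCH, OPEN] **Q⁺ — Coates–Sujatha's Conjecture A at `p = 2` on the cell [`ρ̄₂` onto ∧ `0 < Δ`] (lead g6, (ε) text).**
For every globally minimal, non-CM, analytic-rank-`0`, good-ordinary-at-`2` curve `W/ℚ` with `ρ̄_{W,2}` onto `GL₂(𝔽₂)` and
`0 < Δ_W`, and every cyclotomic `ℤ₂`-extension `κ` of `ℚ`: some (topological generator `γ` and) fine Selmer dual datum `D`
(`X₀ = X(Sel₀(W/ℚ_∞, W[2^∞]))`, STRICT at `∞` — Lim's/Coates–Sujatha's `R(E/ℚ^{cyc})`) is finitely generated over `ℤ₂`. The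
K4 currency of statement (A) at `2` (child 22615 `FineSelmerConjAAtTwoAdditivePotGood`, verbatim conclusion; Lim 2017's `∃ γ D`
spelling), on THIS cell: `ℚ(W[2])` is a totally real NON-ABELIAN `S₃`-sextic there, so Ferrero–Washington and the tree's abelian
road do not apply; IMPLIED (Lim 2017 Thm. 3.5 with Lemma 3.2 at `2`) by Iwasawa's `μ₂ = 0` for `ℚ(W[2], √−1)` (Iw⁺ below) and
IMPLYING (Greenberg 2011 Prop. 4.1.6 at `(ℚ, 2)`) Iwasawa's `μ₂ = 0` for the totally real sextic `ℚ(W[2])`; the converse of the first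
implication is not in print (doc-only correction 2026-08-29, crux-triage r1-2 GEN 36 s82).
By triage Thm F this IS the beyond-print content of the crux on the cell (`μ(X) = μ(X₀^{str ∞})` there). An OPEN CONJECTURE as a
`∀`; kernel instances exist per curve (Fukuda class-group certificates); NOT a Literature fact; nothing asserted.
[cite: CoatesSujatha2005, Conj. A and Thm. 3.4 (shape only; nothing asserted)] [cite: Lim2017FineSelmer, §3 Thm. 3.5 and Lemma 3.2 (shape only)] -/
@[conjecture] def FineSelmerConjATwoOrdPosDisc : Prop :=
  ∀ (W : WeierstrassCurve ℚ) [W.IsElliptic] [W.IsGloballyMinimal], ¬ W.HasCM → W.analyticRank = 0 →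
    Literature.NumberTheory.EllipticCurves.Rank1Residual.GoodOrd W 2 → W.HasSurjectiveModNGaloisRep 2 → 0 < W.Δ →
    ∀ (κ : ZpExtension ℚ 2), κ.IsCyclotomic →
      ∃ (γ : Field.absoluteGaloisGroup ℚ) (D : W.FineSelmerDualData κ γ),
        Module.Finite ℤ_[2] (RestrictScalars ℤ_[2] (IwasawaAlgebra 2) D.X)

/-- `FineSelmerConjATwoOrdPosDisc` unfolds to its displayed body. [folklore] -/
theorem fineSelmerConjATwoOrdPosDisc_iff : FineSelmerConjATwoOrdPosDisc ↔
    ∀ (W : WeierstrassCurve ℚ) [W.IsElliptic] [W.IsGloballyMinimal], ¬ W.HasCM → W.analyticRank = 0 →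
    Literature.NumberTheory.EllipticCurves.Rank1Residual.GoodOrd W 2 → W.HasSurjectiveModNGaloisRep 2 → 0 < W.Δ →
    ∀ (κ : ZpExtension ℚ 2), κ.IsCyclotomic →
      ∃ (γ : Field.absoluteGaloisGroup ℚ) (D : W.FineSelmerDualData κ γ),
        Module.Finite ℤ_[2] (RestrictScalars ℤ_[2] (IwasawaAlgebra 2) D.X) :=
  Iff.rfl

/-- **Monotonicity: statement (A) at `2` for EVERY elliptic `W/ℚ` with `ρ̄_{W,2}` onto implies Q⁺** (drop the binders).
[cite: CoatesSujatha2005, Conj. A (shape only)] -/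
theorem fineSelmerConjATwoOrdPosDisc_of_conjA_two_of_surjective
    (hA : ∀ (W : WeierstrassCurve ℚ) [W.IsElliptic], W.HasSurjectiveModNGaloisRep 2 →
      ∀ (κ : ZpExtension ℚ 2), κ.IsCyclotomic →
        ∃ (γ : Field.absoluteGaloisGroup ℚ) (D : W.FineSelmerDualData κ γ),
          Module.Finite ℤ_[2] (RestrictScalars ℤ_[2] (IwasawaAlgebra 2) D.X)) :
    FineSelmerConjATwoOrdPosDisc :=
  fun W _ _ _ _ _ h2 _ κ hκ => hA W h2 κ hκ

/-! ## §3 Iw⁺ — Iwasawa's `μ₂ = 0` for the carrier `ℚ(E[2], √−1)` on the cell -/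

/-- [RESEARCH, OPEN — a classical named conjecture on a non-abelian family] **Iw⁺ — Iwasawa's `μ = 0` at `p = 2` for the
cyclotomic `ℤ₂`-extension of `ℚ(W[2], √−1)` on the cell [`ρ̄₂` onto ∧ `0 < Δ`] (lead g6, (ε) supply text).** For every globally
minimal, non-CM, analytic-rank-`0`, good-ordinary-at-`2` `W/ℚ` with `ρ̄_{W,2}` onto and `0 < Δ_W`, every `i ∈ ℚ̄` with `i² = −1`
and every cyclotomic `ℤ₂`-extension `κL` of the compositum `ℚ(W[2]) ⊔ ℚ(i)` (a totally imaginary field of degree `12` with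
`Gal(ℚ(W[2], i)/ℚ) ≅ S₃ × C₂`): the classical `μ`-invariant of `κL` vanishes (`IwasawaTheory.ClassicalMuVanishes`, growth form
`e_n = λ n + ν`). Iwasawa's 1973 conjecture («`μ = 0` for the cyclotomic `ℤ_p`-extension of every number field»), PROVED for
abelian ground fields (Ferrero–Washington 1979), OPEN for these non-abelian sextic CM fields; `ℚ(W[2], i) ≤ ℚ(W[4])` with
`2`-power index is the honest carrier of Lim 2017 Thm. 3.5 at `2` (scope rider of the tree fact: «instantiate `L ∋ √−1`»), so
Iw⁺ + Lim@2 BY NAME ⇒ Q⁺ (sequel file), and per curve Fukuda's criterion gives kernel instances from two class groups.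
NOT a Literature fact; nothing asserted. [cite: Iwasawa1973MuInvariants, §1 (the conjecture μ = 0) (shape only; nothing asserted)]
[cite: FerreroWashington1979, Theorem (the abelian case, for contrast)] [cite: Lim2017FineSelmer, §3 Thm. 3.5 (the carrier)] -/
@[conjecture] def ClassicalMuTwoDivisionFieldAdjoinIOrdPosDisc : Prop :=
  ∀ (W : WeierstrassCurve ℚ) [W.IsElliptic] [W.IsGloballyMinimal], ¬ W.HasCM → W.analyticRank = 0 →
    Literature.NumberTheory.EllipticCurves.Rank1Residual.GoodOrd W 2 → W.HasSurjectiveModNGaloisRep 2 → 0 < W.Δ →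
    ∀ (i : AlgebraicClosure ℚ), i ^ 2 = -1 →
      ∀ κL : ZpExtension ↥(W.divisionField 2 ⊔ IntermediateField.adjoin ℚ {i}) 2,
        κL.IsCyclotomic → ClassicalMuVanishes κL

/-- `ClassicalMuTwoDivisionFieldAdjoinIOrdPosDisc` unfolds to its displayed body. [folklore] -/
theorem classicalMuTwoDivisionFieldAdjoinIOrdPosDisc_iff : ClassicalMuTwoDivisionFieldAdjoinIOrdPosDisc ↔
    ∀ (W : WeierstrassCurve ℚ) [W.IsElliptic] [W.IsGloballyMinimal], ¬ W.HasCM → W.analyticRank = 0 →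
    Literature.NumberTheory.EllipticCurves.Rank1Residual.GoodOrd W 2 → W.HasSurjectiveModNGaloisRep 2 → 0 < W.Δ →
    ∀ (i : AlgebraicClosure ℚ), i ^ 2 = -1 →
      ∀ κL : ZpExtension ↥(W.divisionField 2 ⊔ IntermediateField.adjoin ℚ {i}) 2,
        κL.IsCyclotomic → ClassicalMuVanishes κL :=
  Iff.rfl

/-- **Monotonicity: Iwasawa's `μ₂ = 0` for `ℚ(W[2], i)` for EVERY elliptic `W/ℚ` (the full 1973 conjecture on this family)
implies Iw⁺** (drop the binders). [cite: Iwasawa1973MuInvariants, §1 (shape only)] -/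
theorem classicalMuTwoDivisionFieldAdjoinIOrdPosDisc_of_forall
    (hIw : ∀ (W : WeierstrassCurve ℚ) [W.IsElliptic] (i : AlgebraicClosure ℚ), i ^ 2 = -1 →
      ∀ κL : ZpExtension ↥(W.divisionField 2 ⊔ IntermediateField.adjoin ℚ {i}) 2,
        κL.IsCyclotomic → ClassicalMuVanishes κL) :
    ClassicalMuTwoDivisionFieldAdjoinIOrdPosDisc :=
  fun W _ _ _ _ _ _ _ i hi κL hκL => hIw W i hi κL hκL

end Summit.BirchSwinnertonDyer.BirchSwinnertonDyer.Theorems.SteinbergFibreAtTwo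

end
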